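import Literature.Probability.RandomPlanarGeometry.SAWTiles
import Literature.Probability.RandomPlanarGeometry.SAWLists
import HarnessLib

/-!
# Frames of `ℤ²` (the eight lattice symmetries about a site) and list-neighbours in a
# self-avoiding list

Bookkeeping for the local surgery of H. Duminil-Copin, G. Kozma, A. Yadin, *Supercritical
self-avoiding walks are space-filling*, Ann. IHP Probab. Stat. 50 (2014), §3 (proof of
Proposition 7), carried out around a centre `z₀` in one of the eight orientations of the
square lattice. A `Frame` is a centre `z₀` with an ordered pair `(ex, ey)` of perpendicular
axis unit vectors (the dihedral group of order 8); `fr F a b = z₀ + a•ex + b•ey` are the frame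
coordinates, an `ℓ¹`-isometry about `z₀` and a graph automorphism of `ℤ²` (`fx`, `fy`,
`fr_fx_fy`, `l1dist_eq_frame`, `adj_fr_iff`), with the derived frames `mirror` (`ex ↦ -ex`),
`swap` (`ex ↔ ey`) and `rotL` (`(ex, ey) ↦ (-ey, ex)`).

The second part is the "list-neighbour" API of a vertex of a list without repetition
(`ListNbr l w a`: `a` immediately precedes or follows `w`), used to read the local structure of
a self-avoiding walk near a vertex: at most two list-neighbours, exactly the predecessor and
the successor of an interior vertex (`ListNbr.eq_or_eq_of_interior`), a vertex whose
list-neighbours lie in a singleton is an endpoint (`isEnd_of_listNbr_subset_singleton`), and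
two list-neighbours of a vertex assemble to a consecutive triple (`infix_triple_of_listNbr`).
-/

noncomputable section

open Finset Literature.Probability.LatticeModels

namespace Literature.Probability.RandomPlanarGeometry.SAW

/-! ### Frames -/

/-- The admissible ordered pairs of axis unit vectors (perpendicular): the eight elements of the
symmetry group of the square lattice fixing a site. [folklore] -/
def IsFramePair (ex ey : Site 2) : Prop :=
  (ex = pt 1 0 ∧ (ey = pt 0 1 ∨ ey = pt 0 (-1))) ∨ (ex = pt (-1) 0 ∧ (ey = pt 0 1 ∨ ey = pt 0 (-1))) ∨
    (ex = pt 0 1 ∧ (ey = pt 1 0 ∨ ey = pt (-1) 0)) ∨ (ex = pt 0 (-1) ∧ (ey = pt 1 0 ∨ ey = pt (-1) 0))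

/-- A frame: a centre and an admissible ordered pair of axis directions. [folklore] -/
structure Frame where
  /-- the centre -/
  z₀ : Site 2
  /-- the first axis ("east" of the frame) -/
  ex : Site 2
  /-- the second axis ("north" of the frame) -/
  ey : Site 2
  /-- the axes form one of the eight admissible pairs -/
  valid : IsFramePair ex ey

namespace Frame

variable (F : Frame)

/-- The site with frame coordinates `(a, b)`: `z₀ + a•ex + b•ey`. [folklore] -/
def fr (a b : ℤ) : Site 2 := F.z₀ + a • F.ex + b • F.ey

/-- The first frame coordinate of a site. [folklore] -/
def fx (w : Site 2) : ℤ := (w 0 - F.z₀ 0) * F.ex 0 + (w 1 - F.z₀ 1) * F.ex 1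

/-- The second frame coordinate of a site. [folklore] -/
def fy (w : Site 2) : ℤ := (w 0 - F.z₀ 0) * F.ey 0 + (w 1 - F.z₀ 1) * F.ey 1

/-- The standard frame at `z₀` (`ex = e₁`, `ey = e₂`). [folklore] -/
def std (z₀ : Site 2) : Frame := ⟨z₀, pt 1 0, pt 0 1, Or.inl ⟨rfl, Or.inl rfl⟩⟩

/-- The mirrored frame `ex ↦ -ex`. [folklore] -/
def mirror : Frame :=
  ⟨F.z₀, -F.ex, F.ey, by
    rcases F.valid with ⟨h1, h2 | h2⟩ | ⟨h1, h2 | h2⟩ | ⟨h1, h2 | h2⟩ | ⟨h1, h2 | h2⟩ <;>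
      simp [IsFramePair, h1, h2, site_eq_iff]⟩

/-- The frame with the axes exchanged. [folklore] -/
def swap : Frame :=
  ⟨F.z₀, F.ey, F.ex, by
    rcases F.valid with ⟨h1, h2 | h2⟩ | ⟨h1, h2 | h2⟩ | ⟨h1, h2 | h2⟩ | ⟨h1, h2 | h2⟩ <;>
      simp [IsFramePair, h1, h2, site_eq_iff]⟩

/-- The frame rotated so that the old first axis becomes the second one:
`(ex, ey) ↦ (-ey, ex)`. [folklore] -/
def rotL : Frame :=
  ⟨F.z₀, -F.ey, F.ex, by
    rcases F.valid with ⟨h1, h2 | h2⟩ | ⟨h1, h2 | h2⟩ | ⟨h1, h2 | h2⟩ | ⟨h1, h2 | h2⟩ <;>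
      simp [IsFramePair, h1, h2, site_eq_iff]⟩

/-- The frame with the second axis reversed (`ey ↦ -ey`). [folklore] -/
def flipY : Frame :=
  ⟨F.z₀, F.ex, -F.ey, by
    rcases F.valid with ⟨h1, h2 | h2⟩ | ⟨h1, h2 | h2⟩ | ⟨h1, h2 | h2⟩ | ⟨h1, h2 | h2⟩ <;>
      simp [IsFramePair, h1, h2, site_eq_iff]⟩

/-- Component of a derived frame. [folklore] -/
@[simp] theorem mirror_z₀ : F.mirror.z₀ = F.z₀ := rfl

/-- Component of a derived frame. [folklore] -/
@[simp] theorem mirror_ex : F.mirror.ex = -F.ex := rfl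

/-- Component of a derived frame. [folklore] -/
@[simp] theorem mirror_ey : F.mirror.ey = F.ey := rfl

/-- Component of a derived frame. [folklore] -/
@[simp] theorem swap_z₀ : F.swap.z₀ = F.z₀ := rfl

/-- Component of a derived frame. [folklore] -/
@[simp] theorem swap_ex : F.swap.ex = F.ey := rfl

/-- Component of a derived frame. [folklore] -/
@[simp] theorem swap_ey : F.swap.ey = F.ex := rfl

/-- Component of a derived frame. [folklore] -/
@[simp] theorem rotL_z₀ : F.rotL.z₀ = F.z₀ := rfl

/-- Component of a derived frame. [folklore] -/
@[simp] theorem rotL_ex : F.rotL.ex = -F.ey := rfl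

/-- Component of a derived frame. [folklore] -/
@[simp] theorem rotL_ey : F.rotL.ey = F.ex := rfl

/-- Component of a derived frame. [folklore] -/
@[simp] theorem flipY_z₀ : F.flipY.z₀ = F.z₀ := rfl

/-- Component of a derived frame. [folklore] -/
@[simp] theorem flipY_ex : F.flipY.ex = F.ex := rfl

/-- Component of a derived frame. [folklore] -/
@[simp] theorem flipY_ey : F.flipY.ey = -F.ey := rfl

/-- Component of a derived frame. [folklore] -/
@[simp] theorem std_z₀ (z₀ : Site 2) : (std z₀).z₀ = z₀ := rfl

/-- Component of a derived frame. [folklore] -/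
@[simp] theorem std_ex (z₀ : Site 2) : (std z₀).ex = pt 1 0 := rfl

/-- Component of a derived frame. [folklore] -/
@[simp] theorem std_ey (z₀ : Site 2) : (std z₀).ey = pt 0 1 := rfl


/-- Coordinates of `fr F a b`. [folklore] -/
theorem fr_apply (a b : ℤ) (i : Fin 2) : F.fr a b i = F.z₀ i + a * F.ex i + b * F.ey i := by
  simp [fr]

/-- The first coordinate of `fr F a b` is `a`. [folklore] -/
@[simp] theorem fx_fr (a b : ℤ) : F.fx (F.fr a b) = a := by
  simp only [fx, fr_apply]
  rcases F.valid with ⟨h1, h2 | h2⟩ | ⟨h1, h2 | h2⟩ | ⟨h1, h2 | h2⟩ | ⟨h1, h2 | h2⟩ <;>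
    simp [h1, h2]

/-- The second coordinate of `fr F a b` is `b`. [folklore] -/
@[simp] theorem fy_fr (a b : ℤ) : F.fy (F.fr a b) = b := by
  simp only [fy, fr_apply]
  rcases F.valid with ⟨h1, h2 | h2⟩ | ⟨h1, h2 | h2⟩ | ⟨h1, h2 | h2⟩ | ⟨h1, h2 | h2⟩ <;>
    simp [h1, h2]

/-- Every site has frame coordinates. [folklore] -/
theorem fr_fx_fy (w : Site 2) : F.fr (F.fx w) (F.fy w) = w := by
  rw [site_eq_iff]
  simp only [fx, fy, fr_apply]
  rcases F.valid with ⟨h1, h2 | h2⟩ | ⟨h1, h2 | h2⟩ | ⟨h1, h2 | h2⟩ | ⟨h1, h2 | h2⟩ <;>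
    simp [h1, h2]

/-- `fr` is injective. [folklore] -/
theorem fr_inj {a b a' b' : ℤ} (h : F.fr a b = F.fr a' b') : a = a' ∧ b = b' := by
  have hx := congrArg F.fx h
  have hy := congrArg F.fy h
  simp only [fx_fr, fy_fr] at hx hy
  exact ⟨hx, hy⟩

/-- Sites are equal iff their frame coordinates are. [folklore] -/
theorem eq_iff_fx_fy {w w' : Site 2} : w = w' ↔ F.fx w = F.fx w' ∧ F.fy w = F.fy w' := by
  constructor
  · rintro rfl; exact ⟨rfl, rfl⟩
  · rintro ⟨hx, hy⟩
    rw [← F.fr_fx_fy w, ← F.fr_fx_fy w', hx, hy]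

/-- A site equals `fr F a b` iff its coordinates are `a, b`. [folklore] -/
theorem eq_fr_iff {w : Site 2} {a b : ℤ} : w = F.fr a b ↔ F.fx w = a ∧ F.fy w = b := by
  rw [F.eq_iff_fx_fy, fx_fr, fy_fr]

/-- The centre has coordinates `(0, 0)`. [folklore] -/
@[simp] theorem fr_zero_zero : F.fr 0 0 = F.z₀ := by simp [fr]

/-- **A frame is an `ℓ¹`-isometry about its centre.** [folklore] -/
theorem l1dist_fr (a b : ℤ) : l1dist (F.fr a b) F.z₀ = |a| + |b| := by
  simp only [l1dist, fr_apply]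
  rcases F.valid with ⟨h1, h2 | h2⟩ | ⟨h1, h2 | h2⟩ | ⟨h1, h2 | h2⟩ | ⟨h1, h2 | h2⟩ <;>
    simp [h1, h2, abs_neg, add_comm]

/-- The `ℓ¹`-distance to the centre in frame coordinates. [folklore] -/
theorem l1dist_eq_frame (w : Site 2) : l1dist w F.z₀ = |F.fx w| + |F.fy w| := by
  conv_lhs => rw [← F.fr_fx_fy w]
  exact F.l1dist_fr _ _

/-- The `ℓ^∞`-distance to the centre in frame coordinates. [folklore] -/
theorem linfdist_fr (a b : ℤ) : linfdist (F.fr a b) F.z₀ = max |a| |b| := by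
  simp only [linfdist, fr_apply]
  rcases F.valid with ⟨h1, h2 | h2⟩ | ⟨h1, h2 | h2⟩ | ⟨h1, h2 | h2⟩ | ⟨h1, h2 | h2⟩ <;>
    simp [h1, h2, abs_neg, max_comm]

/-- **A frame is a graph automorphism of `ℤ²`**: adjacency in frame coordinates.
[folklore] -/
theorem adj_fr_iff (a b a' b' : ℤ) :
    (zdGraph 2).Adj (F.fr a b) (F.fr a' b') ↔
      ((a' = a + 1 ∨ a = a' + 1) ∧ b' = b) ∨ ((b' = b + 1 ∨ b = b' + 1) ∧ a' = a) := by
  rw [adj_iff_coord]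
  simp only [fr_apply]
  rcases F.valid with ⟨h1, h2 | h2⟩ | ⟨h1, h2 | h2⟩ | ⟨h1, h2 | h2⟩ | ⟨h1, h2 | h2⟩ <;>
    simp [h1, h2] <;> omega

/-- Adjacency of two sites in frame coordinates. [folklore] -/
theorem adj_iff_frame (w w' : Site 2) :
    (zdGraph 2).Adj w w' ↔
      ((F.fx w' = F.fx w + 1 ∨ F.fx w = F.fx w' + 1) ∧ F.fy w' = F.fy w) ∨
        ((F.fy w' = F.fy w + 1 ∨ F.fy w = F.fy w' + 1) ∧ F.fx w' = F.fx w) := by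
  conv_lhs => rw [← F.fr_fx_fy w, ← F.fr_fx_fy w']
  exact F.adj_fr_iff _ _ _ _

/-- Coordinates in the mirrored frame. [folklore] -/
@[simp] theorem mirror_fr (a b : ℤ) : F.mirror.fr a b = F.fr (-a) b := by
  simp [fr]

/-- Coordinates in the swapped frame. [folklore] -/
@[simp] theorem swap_fr (a b : ℤ) : F.swap.fr a b = F.fr b a := by
  simp [fr]; abel

/-- Coordinates in the rotated frame. [folklore] -/
@[simp] theorem rotL_fr (a b : ℤ) : F.rotL.fr a b = F.fr b (-a) := by
  simp [fr]; abel

/-- Coordinates in the flipped frame. [folklore] -/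
@[simp] theorem flipY_fr (a b : ℤ) : F.flipY.fr a b = F.fr a (-b) := by
  simp [fr]

/-- Coordinates in the standard frame. [folklore] -/
theorem std_fr (z₀ : Site 2) (a b : ℤ) : (std z₀).fr a b = z₀ + pt a b := by
  rw [site_eq_iff]; simp [fr_apply, pt]

/-- The first coordinate in the mirrored frame. [folklore] -/
@[simp] theorem fx_mirror (w : Site 2) : F.mirror.fx w = -F.fx w := by
  simp [fx]; ring

/-- The second coordinate in the mirrored frame. [folklore] -/
@[simp] theorem fy_mirror (w : Site 2) : F.mirror.fy w = F.fy w := rfl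

/-- The coordinates in the swapped frame. [folklore] -/
@[simp] theorem fx_swap (w : Site 2) : F.swap.fx w = F.fy w := rfl

/-- The coordinates in the swapped frame. [folklore] -/
@[simp] theorem fy_swap (w : Site 2) : F.swap.fy w = F.fx w := rfl

/-- The coordinates in the rotated frame. [folklore] -/
@[simp] theorem fx_rotL (w : Site 2) : F.rotL.fx w = -F.fy w := by
  simp [fx, fy]; ring

/-- The coordinates in the rotated frame. [folklore] -/
@[simp] theorem fy_rotL (w : Site 2) : F.rotL.fy w = F.fx w := rfl

/-- The coordinates in the flipped frame. [folklore] -/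
@[simp] theorem fx_flipY (w : Site 2) : F.flipY.fx w = F.fx w := rfl

/-- The coordinates in the flipped frame. [folklore] -/
@[simp] theorem fy_flipY (w : Site 2) : F.flipY.fy w = -F.fy w := by
  simp [fy]; ring

/-- The coordinates in the standard frame. [folklore] -/
@[simp] theorem fx_std (z₀ w : Site 2) : (std z₀).fx w = w 0 - z₀ 0 := by simp [fx, std, pt]

/-- The coordinates in the standard frame. [folklore] -/
@[simp] theorem fy_std (z₀ w : Site 2) : (std z₀).fy w = w 1 - z₀ 1 := by simp [fy, std, pt]

end Frame

/-! ### List-neighbours of a vertex of a list without repetition -/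

section ListNbr

variable {V : Type*}

/-- `a` is a list-neighbour of `w` in `l`: it immediately precedes or follows `w`. [folklore] -/
def ListNbr (l : List V) (w a : V) : Prop := [a, w] <:+: l ∨ [w, a] <:+: l

/-- `w` is an endpoint of the (non-empty) list `l`. [folklore] -/
def IsEnd (l : List V) (w : V) : Prop := l.head? = some w ∨ l.getLast? = some w

/-- List-neighbours are members. [folklore] -/
theorem ListNbr.mem {l : List V} {w a : V} (h : ListNbr l w a) : a ∈ l := by
  rcases h with ⟨s, t, hst⟩ | ⟨s, t, hst⟩ <;> rw [← hst] <;> simp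

/-- The vertex of a list-neighbour is a member. [folklore] -/
theorem ListNbr.mem_left {l : List V} {w a : V} (h : ListNbr l w a) : w ∈ l := by
  rcases h with ⟨s, t, hst⟩ | ⟨s, t, hst⟩ <;> rw [← hst] <;> simp

/-- List-neighbourhood is symmetric. [folklore] -/
theorem ListNbr.symm {l : List V} {w a : V} (h : ListNbr l w a) : ListNbr l a w :=
  Or.symm h

/-- In a chain, list-neighbours are related. [folklore] -/
theorem ListNbr.rel {R : V → V → Prop} (hR : ∀ x y, R x y → R y x) {l : List V} {w a : V}
    (hl : l.IsChain R) (h : ListNbr l w a) : R w a := by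
  rcases h with h | h
  · exact hR _ _ (rel_of_infix_pair hl h)
  · exact rel_of_infix_pair hl h

variable [DecidableEq V]

/-- **An interior vertex of a list without repetition has exactly its predecessor and its
successor as list-neighbours.** [folklore] -/
theorem exists_pred_succ {l : List V} (hl : l.Nodup) {w : V} (hw : w ∈ l) (hend : ¬IsEnd l w) :
    ∃ a b, [a, w, b] <:+: l ∧ a ≠ b ∧ ∀ c, ListNbr l w c → c = a ∨ c = b := by
  have hne : l ≠ [] := List.ne_nil_of_mem hw
  rw [IsEnd, not_or, List.head?_eq_some_head hne, List.getLast?_eq_some_getLast hne] at hend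
  simp only [Option.some.injEq] at hend
  obtain ⟨a, ha⟩ := exists_infix_pair_left hw hne (Ne.symm hend.1)
  obtain ⟨b, hb⟩ := exists_infix_pair_right hw hne (Ne.symm hend.2)
  have htri := infix_triple_of_pairs hl ha hb
  refine ⟨a, b, htri, (ne_of_infix_triple hl htri).1, fun c hc => ?_⟩
  rcases hc with hc | hc
  · exact Or.inl (eq_of_infix_pair_left hl hc ha)
  · exact Or.inr (eq_of_infix_pair_right hl hc hb)

/-- Two distinct list-neighbours of a vertex are its predecessor and successor, so any
list-neighbour is one of them. [folklore] -/
theorem ListNbr.eq_or_eq {l : List V} (hl : l.Nodup) {w a b c : V} (ha : ListNbr l w a)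
    (hb : ListNbr l w b) (hab : a ≠ b) (hc : ListNbr l w c) : c = a ∨ c = b := by
  rcases ha with ha | ha <;> rcases hb with hb | hb
  · exact absurd (eq_of_infix_pair_left hl ha hb) hab
  · rcases hc with hc | hc
    · exact Or.inl (eq_of_infix_pair_left hl hc ha)
    · exact Or.inr (eq_of_infix_pair_right hl hc hb)
  · rcases hc with hc | hc
    · exact Or.inr (eq_of_infix_pair_left hl hc hb)
    · exact Or.inl (eq_of_infix_pair_right hl hc ha)
  · exact absurd (eq_of_infix_pair_right hl ha hb) hab

/-- Two distinct list-neighbours of a vertex assemble to a consecutive triple. [folklore] -/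
theorem infix_triple_of_listNbr {l : List V} (hl : l.Nodup) {w a b : V} (ha : ListNbr l w a)
    (hb : ListNbr l w b) (hab : a ≠ b) : [a, w, b] <:+: l ∨ [b, w, a] <:+: l := by
  rcases ha with ha | ha <;> rcases hb with hb | hb
  · exact absurd (eq_of_infix_pair_left hl ha hb) hab
  · exact Or.inl (infix_triple_of_pairs hl ha hb)
  · exact Or.inr (infix_triple_of_pairs hl hb ha)
  · exact absurd (eq_of_infix_pair_right hl ha hb) hab

/-- A vertex all of whose list-neighbours coincide with one given vertex is an endpoint.
[folklore] -/
theorem isEnd_of_listNbr_subset_singleton {l : List V} (hl : l.Nodup) {w : V} (hw : w ∈ l)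
    (c : V) (h : ∀ a, ListNbr l w a → a = c) : IsEnd l w := by
  by_contra hend
  obtain ⟨a, b, htri, hab, -⟩ := exists_pred_succ hl hw hend
  obtain ⟨s, t, hst⟩ := htri
  have ha : ListNbr l w a := Or.inl ⟨s, b :: t, by rw [← hst]; simp⟩
  have hb : ListNbr l w b := Or.inr ⟨s ++ [a], t, by rw [← hst]; simp⟩
  exact hab ((h a ha).trans (h b hb).symm)

/-- In a list with at least two elements every vertex has a list-neighbour. [folklore] -/
theorem exists_listNbr {l : List V} (hl2 : 2 ≤ l.length) {w : V} (hw : w ∈ l) :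
    ∃ a, ListNbr l w a := by
  rcases l with _ | ⟨x, tl⟩
  · simp at hw
  rcases tl with _ | ⟨y, rest⟩
  · simp at hl2
  by_cases hh : w = x
  · subst hh; exact ⟨y, Or.inr ⟨[], rest, by simp⟩⟩
  · obtain ⟨a, ha⟩ := exists_infix_pair_left hw (by simp) (by simpa using hh)
    exact ⟨a, Or.inl ha⟩

omit [DecidableEq V] in
/-- The head is an endpoint. [folklore] -/
theorem isEnd_of_head?_eq {l : List V} {w : V} (h : l.head? = some w) : IsEnd l w := Or.inl h

omit [DecidableEq V] in
/-- The last vertex is an endpoint. [folklore] -/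
theorem isEnd_of_getLast?_eq {l : List V} {w : V} (h : l.getLast? = some w) : IsEnd l w := Or.inr h

omit [DecidableEq V] in
/-- Endpoints of a list from `u` to `v` are `u` or `v`. [folklore] -/
theorem IsEnd.eq_or_eq {l : List V} {u v w : V} (hu : l.head? = some u) (hv : l.getLast? = some v)
    (h : IsEnd l w) : w = u ∨ w = v := by
  rcases h with h | h
  · rw [hu] at h; exact Or.inl (Option.some_inj.1 h).symm
  · rw [hv] at h; exact Or.inr (Option.some_inj.1 h).symm

end ListNbr

end Literature.Probability.RandomPlanarGeometry.SAW
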